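import Mathlib
import Literature.MathematicalPhysics.StatisticalMechanics.BarlowStacking
import Summits.AtomisticToContinuum.Crystallization.Theorems.ThreeConeCertificateSlackRigidityLayeringIdeal

/-!
# Route `NashClassCertificates`, crux `NashNearField` (stmt-AtomisticToContinuum-16827), line `birth`:
# pieces for the stub `stub_localSmoothCertificateOfSitewise` (SITEWISE ⇒ LSC), I — the matched reference
# of a flatness witness

The local smooth certificate expands each radius-8 interior site energy about the REFERENCE read off the site's
flatness witness `(s_i, G_i, ν_i)` of B″: every particle `j` within `3` of `x i` is within `ν_i` of a template
point `x i + G_i(barlowPos 1 (√6/3) s_i q)`, and `G_i` is bi-Lipschitz with constants `4/5, 6/5`.  The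
expansion pieces (`stub_siteExpansionRemainder`, `stub_calibratedSiteExpansion`, landed) need this matching to be a
genuine reference: unique matched sites, injective in the particle, centred (`x i ↦ 0`), with every non-trivial
reference bond dominating its displacement.  All four follow from the uniform discreteness of the unit template
(`le_dist_barlowPos`: distinct sites are `≥ √6/3` apart) and the `1/3`-separation, for `ν < √6/15 ≈ 0.163`:

* `norm_barlowPos_unit_ge` — a unit template site other than the origin has norm `≥ √6/3`;
* `stub_matchedSiteUnique` — a vector is within `ν < (2/5)(√6/3)` of at most ONE image site `G q`;
* `stub_matchedParticleUnique` — an image site is within `ν < 1/6` of at most ONE particle (`1/3`-separation);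
* `stub_centreMatchesOrigin` — the centre `x i − x i = 0` matches only the origin site (`ν < (4/5)(√6/3)`);
* `stub_bondDomination` — for `q ≠ 0` and `‖w‖ ≤ ν ≤ √6/15`, `‖w‖ ≤ ‖G(barlowPos 1 (√6/3) s q)‖/4`, the
  hypothesis of the one-bond Taylor bound `stub_ljPairTaylor` / `stub_siteExpansionRemainder`.

All `[folklore]`.
-/

noncomputable section

open Literature.MathematicalPhysics.StatisticalMechanics
open Summit.AtomisticToContinuum.Crystallization.Theorems.CLayerWitnessLayeringIdeal (barlowPos_zero_zero_zero)

namespace Summit.AtomisticToContinuum.Crystallization.Theorems.NashClassCertificatesNashNearField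

/-- `√6/3 ≤ 1`. [folklore] -/
theorem sqrt_six_div_three_le_one : Real.sqrt 6 / 3 ≤ 1 := by
  rw [div_le_one (by norm_num : (0 : ℝ) < 3)]
  rw [show (3 : ℝ) = Real.sqrt 9 by rw [show (9 : ℝ) = 3 ^ 2 by norm_num, Real.sqrt_sq (by norm_num : (0:ℝ) ≤ 3)]]
  exact Real.sqrt_le_sqrt (by norm_num)

/-- **A unit template site other than the origin has norm at least `√6/3`** (uniform discreteness of the unit
ideal template, `le_dist_barlowPos` against the origin site). [folklore] -/
theorem norm_barlowPos_unit_ge (s : ℤ → ℤ) {k i j : ℤ} (hq : (k, i, j) ≠ (0, 0, 0)) :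
    Real.sqrt 6 / 3 ≤ ‖barlowPos 1 (Real.sqrt 6 / 3) s k i j‖ := by
  have h := le_dist_barlowPos 1 (Real.sqrt 6 / 3) s zero_le_one (by positivity) hq
  rw [barlowPos_zero_zero_zero, dist_zero_right, min_eq_right sqrt_six_div_three_le_one] at h
  exact h

/-- Distinct unit template sites have bi-Lipschitz images at least `(4/5)(√6/3)` apart. [folklore] -/
theorem norm_image_sub_ge (s : ℤ → ℤ) (G : EuclideanSpace ℝ (Fin 3) →L[ℝ] EuclideanSpace ℝ (Fin 3))
    (hG : ∀ p : EuclideanSpace ℝ (Fin 3), 4 / 5 * ‖p‖ ≤ ‖G p‖) {k i j k' i' j' : ℤ}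
    (hne : (k, i, j) ≠ (k', i', j')) :
    4 / 5 * (Real.sqrt 6 / 3) ≤
      ‖G (barlowPos 1 (Real.sqrt 6 / 3) s k i j) - G (barlowPos 1 (Real.sqrt 6 / 3) s k' i' j')‖ := by
  have h := le_dist_barlowPos 1 (Real.sqrt 6 / 3) s zero_le_one (by positivity) hne
  rw [min_eq_right sqrt_six_div_three_le_one, dist_eq_norm] at h
  rw [← map_sub]
  exact (mul_le_mul_of_nonneg_left h (by norm_num)).trans (hG _)

/-- **Stub piece `stub_matchedSiteUnique` (proved).**  Under the lower bi-Lipschitz bound `‖G p‖ ≥ (4/5)‖p‖`, a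
vector `v` lies within `ν < (2/5)(√6/3)` of the image of at most one unit template site: the matched site of a
particle in a flatness witness is unique. [folklore] -/
theorem stub_matchedSiteUnique :
    ∀ (s : ℤ → ℤ) (G : EuclideanSpace ℝ (Fin 3) →L[ℝ] EuclideanSpace ℝ (Fin 3)) (ν : ℝ),
      (∀ p : EuclideanSpace ℝ (Fin 3), 4 / 5 * ‖p‖ ≤ ‖G p‖) → ν < 2 / 5 * (Real.sqrt 6 / 3) →
      ∀ (v : EuclideanSpace ℝ (Fin 3)) (k i j k' i' j' : ℤ),
        dist v (G (barlowPos 1 (Real.sqrt 6 / 3) s k i j)) ≤ ν →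
        dist v (G (barlowPos 1 (Real.sqrt 6 / 3) s k' i' j')) ≤ ν → (k, i, j) = (k', i', j') := by
  intro s G ν hG hν v k i j k' i' j' h1 h2
  by_contra hne
  have hsep := norm_image_sub_ge s G hG hne
  have htri : ‖G (barlowPos 1 (Real.sqrt 6 / 3) s k i j) - G (barlowPos 1 (Real.sqrt 6 / 3) s k' i' j')‖ ≤ 2 * ν := by
    rw [← dist_eq_norm]
    have := dist_triangle_left (G (barlowPos 1 (Real.sqrt 6 / 3) s k i j))
      (G (barlowPos 1 (Real.sqrt 6 / 3) s k' i' j')) v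
    linarith
  linarith

/-- **Stub piece `stub_matchedParticleUnique` (proved).**  In a `1/3`-separated configuration an image site is
within `ν < 1/6` of the relative position of at most one particle: the matching of a flatness witness is injective
in the particle. [folklore] -/
theorem stub_matchedParticleUnique :
    ∀ (N : ℕ) (x : Fin N → EuclideanSpace ℝ (Fin 3)), (∀ i j : Fin N, i ≠ j → 1 / 3 ≤ dist (x i) (x j)) →
      ∀ (ν : ℝ), ν < 1 / 6 → ∀ (i j j' : Fin N) (z : EuclideanSpace ℝ (Fin 3)),
        dist (x j - x i) z ≤ ν → dist (x j' - x i) z ≤ ν → j = j' := by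
  intro N x hsep ν hν i j j' z h1 h2
  by_contra hne
  have h := hsep j j' hne
  have htri : dist (x j) (x j') ≤ 2 * ν := by
    have e : dist (x j) (x j') = dist (x j - x i) (x j' - x i) := by
      rw [dist_eq_norm, dist_eq_norm, sub_sub_sub_cancel_right]
    rw [e]
    have := dist_triangle_right (x j - x i) (x j' - x i) z
    linarith
  linarith

/-- **Stub piece `stub_centreMatchesOrigin` (proved).**  The centre of a flatness witness matches only the origin site:
if `dist 0 (G (barlowPos 1 (√6/3) s k i j)) ≤ ν` with `ν < (4/5)(√6/3)` then `(k, i, j) = (0, 0, 0)` — so in the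
site-centred gauge the displacement of the centre vanishes (`u i = 0`, no work term `⟪F_i, u i⟫`). [folklore] -/
theorem stub_centreMatchesOrigin :
    ∀ (s : ℤ → ℤ) (G : EuclideanSpace ℝ (Fin 3) →L[ℝ] EuclideanSpace ℝ (Fin 3)) (ν : ℝ),
      (∀ p : EuclideanSpace ℝ (Fin 3), 4 / 5 * ‖p‖ ≤ ‖G p‖) → ν < 4 / 5 * (Real.sqrt 6 / 3) →
      ∀ (k i j : ℤ), dist (0 : EuclideanSpace ℝ (Fin 3)) (G (barlowPos 1 (Real.sqrt 6 / 3) s k i j)) ≤ ν →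
        (k, i, j) = (0, 0, 0) := by
  intro s G ν hG hν k i j hd
  by_contra hne
  have h1 := norm_barlowPos_unit_ge s hne
  have h2 := hG (barlowPos 1 (Real.sqrt 6 / 3) s k i j)
  rw [dist_zero_left] at hd
  linarith [mul_le_mul_of_nonneg_left h1 (by norm_num : (0 : ℝ) ≤ 4 / 5)]

/-- **Stub piece `stub_bondDomination` (proved).**  For a non-origin unit site `q` and a displacement `w` with
`‖w‖ ≤ ν ≤ √6/15`, the reference bond dominates: `‖w‖ ≤ ‖G (barlowPos 1 (√6/3) s q)‖ / 4` — the hypothesis of the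
one-bond Taylor bound (`stub_ljPairTaylor`, `stub_siteExpansionRemainder`) for every bond of the matched reference,
hence the smooth-regime cap `ν₁ ≤ √6/15 ≈ 0.163` suffices for the sitewise expansion. [folklore] -/
theorem stub_bondDomination :
    ∀ (s : ℤ → ℤ) (G : EuclideanSpace ℝ (Fin 3) →L[ℝ] EuclideanSpace ℝ (Fin 3)) (ν : ℝ),
      (∀ p : EuclideanSpace ℝ (Fin 3), 4 / 5 * ‖p‖ ≤ ‖G p‖) → ν ≤ Real.sqrt 6 / 15 →
      ∀ (k i j : ℤ), (k, i, j) ≠ (0, 0, 0) → ∀ (w : EuclideanSpace ℝ (Fin 3)), ‖w‖ ≤ ν →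
        ‖w‖ ≤ ‖G (barlowPos 1 (Real.sqrt 6 / 3) s k i j)‖ / 4 := by
  intro s G ν hG hν k i j hq w hw
  have h1 := norm_barlowPos_unit_ge s hq
  have h2 := hG (barlowPos 1 (Real.sqrt 6 / 3) s k i j)
  have h3 : 4 / 5 * (Real.sqrt 6 / 3) ≤ ‖G (barlowPos 1 (Real.sqrt 6 / 3) s k i j)‖ :=
    (mul_le_mul_of_nonneg_left h1 (by norm_num)).trans h2
  linarith

end Summit.AtomisticToContinuum.Crystallization.Theorems.NashClassCertificatesNashNearField

end
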